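import Mathlib
import Literature.NumberTheory.Transcendental.PeriodConjecture
import Literature.NumberTheory.Transcendental.KZKernelConjectureForms
import Summits.KontsevichZagierPeriods.KontsevichZagierPeriods.Statement
import Summits.KontsevichZagierPeriods.KontsevichZagierPeriods.Theses.InverseLandau
import Summits.KontsevichZagierPeriods.KontsevichZagierPeriods.Theorems.InverseLandauTateLiftingGenLifting
import Summits.KontsevichZagierPeriods.KontsevichZagierPeriods.Theorems.InverseLandauTateLiftingForms
import Literature.Barriers.KontsevichZagierPeriods.GrothendieckPeriodConjectureDependence

/-!
# Crux `TateLifting` (stmt-KontsevichZagierPeriods-9129) — STRATEGY CENSUS, kernel-checked part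

Crux-strategist seat `cstrat-stmt-KontsevichZagierPeriods-9129-s2` (2026-08-17), alongside the live lead
of line `Sketch`.  This file types the four census headings (Transfer / Strengthen / Decomposition /
Negation) as statements about the crux and PROVES the structural facts that decide each heading.
Nothing here asserts `TateLifting`, `TateFamilyKernel` or the summit; there is no `sorry`.

Summary of what is proved below (all elementary, over the landed
`kzKernelConjecture_iff_tateFamilyKernel_and_tateLifting` (p124745),
`TateLifting_of_kzKernelConjecture` (p107000) and `kzKernelConjecture_iff_isRational`):

* THE SANDWICH: `KontsevichZagierPeriods → TateLifting` and
  `TateFamilyKernel → (TateLifting ↔ KontsevichZagierPeriods)` — the crux is a CONSEQUENCE of the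
  summit and is the summit modulo the route's other (accessible, Ayoub-type) crux.
* STRENGTHEN: any `S⁺` with `Summit → S⁺ → TateLifting` is again summit-equivalent modulo
  `TateFamilyKernel` (`sandwich_strengthening`); the natural rigid candidate `PureTateLifting`
  (one fibre, no ℤ-combination) is such an `S⁺`.
* DECOMPOSITION: the generic SECTOR SPLIT `SectorLifting S ∧ ResidualLifting S ↔ TateLifting`
  (glue proved) — the residual child is implied by the crux and implies it back given the sector
  child, so it "remains the whole crux"; and the NORMAL-FORM SPLIT
  `CubeRegularNormalForm → CubeRegularLifting → TateLifting` (glue proved) with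
  `TateLifting → CubeRegularLifting`, so the lifting child is crux-equivalent given the normal form.
* NEGATION: `¬ TateLifting → ¬ KontsevichZagierPeriods` (a counterexample refutes the summit), and
  the INVARIANT FORM `TateLifting ↔ (every additive invariant killing the moves and the Tate fibres
  kills ker eval)` — so refuting the crux by an invariant IS deciding the crux.
-/

noncomputable section

namespace Summit.KontsevichZagierPeriods.InverseLandau.Strategist

open Literature.NumberTheory.Transcendental
open Summit.KontsevichZagierPeriods.KontsevichZagierPeriods.Theses.InverseLandau
  (TateLifting TateFamilyKernel)
open Summit.KontsevichZagierPeriods.InverseLandau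

/-- The crux's generating set `T` of Tate fibres, verbatim from `TateLifting`. [folklore] -/
def tateFibres : Set KZ.FormalRep :=
  {d : KZ.FormalRep | ∃ (n : ℕ) (P Q : MvPolynomial (Fin (n + 1)) ℚ) (ε ϖ₀ : ℝ)
      (r : KZ.IntegralRep n), 0 < ε ∧
    (∃ c₀ : ℚ, c₀ ≠ 0 ∧ ∀ z : Fin n → ℝ,
      MvPolynomial.aeval (Fin.snoc z (0 : ℝ) : Fin (n + 1) → ℝ) Q = (c₀ : ℝ)) ∧
    (∀ (z : Fin n → ℝ) (ϖ : ℝ), (∀ i, z i ∈ Set.Icc (0 : ℝ) 1) → ϖ ∈ Set.Ioo 0 ε →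
      MvPolynomial.aeval (Fin.snoc z ϖ : Fin (n + 1) → ℝ) Q ≠ 0) ∧
    (∀ ϖ ∈ Set.Ioo (0 : ℝ) ε, ∫ z in Set.pi Set.univ (fun _ : Fin n => Set.Ioo (0 : ℝ) 1),
      MvPolynomial.aeval (Fin.snoc z ϖ : Fin (n + 1) → ℝ) P /
        MvPolynomial.aeval (Fin.snoc z ϖ : Fin (n + 1) → ℝ) Q = 0) ∧
    IsAlgebraic ℚ ϖ₀ ∧ ϖ₀ ∈ Set.Ioo 0 ε ∧
    r.domain = Set.pi Set.univ (fun _ : Fin n => Set.Ioo (0 : ℝ) 1) ∧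
    Set.EqOn r.integrand (fun z => MvPolynomial.aeval (Fin.snoc z ϖ₀ : Fin (n + 1) → ℝ) P /
      MvPolynomial.aeval (Fin.snoc z ϖ₀ : Fin (n + 1) → ℝ) Q) r.domain ∧
    d = KZ.of r}

/-- `TateLifting` is literally `ker eval ⊆ relations ⊔ closure tateFibres`. [folklore] -/
theorem tateLifting_iff :
    TateLifting ↔ ∀ c : KZ.FormalRep, KZ.eval c = 0 →
      c ∈ KZ.relations ⊔ AddSubgroup.closure tateFibres :=
  Iff.rfl

/-! ## The sandwich: Summit → TateLifting → (TateFamilyKernel → Summit) -/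

/-- The summit (KZ's Conjecture 1 in its printed two-representation form) is the kernel form.
[cite: KontsevichZagier2001, §1.2 Conjecture 1] -/
theorem summit_iff_kernel : KontsevichZagierPeriods ↔ KZKernelConjecture :=
  kzKernelConjecture_iff_isRational.symm

/-- The crux is a CONSEQUENCE of the summit (empty fibre combination).
[cite: KontsevichZagier2001, §1.2 Conjecture 1] -/
theorem tateLifting_of_summit (h : KontsevichZagierPeriods) : TateLifting :=
  TateLifting_of_kzKernelConjecture (summit_iff_kernel.mp h)

/-- Modulo the route's other crux `TateFamilyKernel`, the crux IS the summit.
[cite: KontsevichZagier2001, §1.2 Conjecture 1] -/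
theorem tateLifting_iff_summit_of_tateFamilyKernel (hK : TateFamilyKernel) :
    TateLifting ↔ KontsevichZagierPeriods := by
  rw [summit_iff_kernel, kzKernelConjecture_iff_tateFamilyKernel_and_tateLifting]
  exact ⟨fun hL => ⟨hK, hL⟩, fun h => h.2⟩

/-- The summit also implies the other crux, so the summit is EXACTLY the conjunction.
[cite: KontsevichZagier2001, §1.2 Conjecture 1] -/
theorem summit_iff_pair : KontsevichZagierPeriods ↔ TateFamilyKernel ∧ TateLifting :=
  summit_iff_kernel.trans kzKernelConjecture_iff_tateFamilyKernel_and_tateLifting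

/-! ## STRENGTHEN — every summit-implied strengthening is summit-equivalent mod `TateFamilyKernel` -/

/-- Any statement between the summit and the crux is, like the crux, the summit modulo
`TateFamilyKernel`: strengthening inside the sandwich buys no leverage. [folklore] -/
theorem sandwich_strengthening (S : Prop) (h₁ : KontsevichZagierPeriods → S) (h₂ : S → TateLifting)
    (hK : TateFamilyKernel) : S ↔ KontsevichZagierPeriods :=
  ⟨fun hS => (tateLifting_iff_summit_of_tateFamilyKernel hK).mp (h₂ hS), h₁⟩

/-- The rigid candidate `S⁺`: PURE lifting — every vanishing combination is, modulo the moves,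
ONE Tate fibre (or zero), no ℤ-combination of fibres needed (the pencil-saturation card's K1/K2
shape). [folklore] -/
def PureTateLifting : Prop :=
  ∀ c : KZ.FormalRep, KZ.eval c = 0 → ∃ t ∈ insert (0 : KZ.FormalRep) tateFibres, c - t ∈ KZ.relations

/-- `PureTateLifting → TateLifting`. [folklore] -/
theorem tateLifting_of_pure (h : PureTateLifting) : TateLifting := by
  intro c hc
  obtain ⟨t, ht, hct⟩ := h c hc
  have ht' : t ∈ KZ.relations ⊔ AddSubgroup.closure tateFibres := by
    rcases Set.mem_insert_iff.mp ht with rfl | ht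
    · exact zero_mem _
    · exact AddSubgroup.mem_sup_right (AddSubgroup.subset_closure ht)
  have := add_mem (AddSubgroup.mem_sup_left (T := AddSubgroup.closure tateFibres) hct) ht'
  rw [sub_add_cancel] at this
  exact this

/-- … and the summit implies `PureTateLifting` (take `t = 0`), so `PureTateLifting` sits inside the
sandwich and is summit-equivalent modulo `TateFamilyKernel`. [folklore] -/
theorem pure_of_summit (h : KontsevichZagierPeriods) : PureTateLifting :=
  fun c hc => ⟨0, Set.mem_insert _ _, by simpa using summit_iff_kernel.mp h c hc⟩

theorem pure_iff_summit_of_tateFamilyKernel (hK : TateFamilyKernel) :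
    PureTateLifting ↔ KontsevichZagierPeriods :=
  sandwich_strengthening _ pure_of_summit tateLifting_of_pure hK

/-! ## DECOMPOSITION (1) — the sector split: glue proved, residual child ≡ crux given the sector -/

/-- Sector child: the crux restricted to the subgroup generated by a set `S` of representations
(the leads' sectors: dimension 0, dimension ≤ 1 algebraic, genus zero, cylinders, rotations,
polytopes …; the next credible one is the 1-period sector via Huber–Wüstholz). [folklore] -/
def SectorLifting (S : Set KZ.FormalRep) : Prop :=
  ∀ c ∈ AddSubgroup.closure S, KZ.eval c = 0 → c ∈ KZ.relations ⊔ AddSubgroup.closure tateFibres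

/-- Residual child: the crux modulo the vanishing part of the sector. [folklore] -/
def ResidualLifting (S : Set KZ.FormalRep) : Prop :=
  ∀ c : KZ.FormalRep, KZ.eval c = 0 →
    c ∈ (KZ.relations ⊔ AddSubgroup.closure tateFibres) ⊔ (AddSubgroup.closure S ⊓ KZ.eval.ker)

/-- GLUE of the sector split: `SectorLifting S → ResidualLifting S → TateLifting`. [folklore] -/
theorem tateLifting_of_sector_split (S : Set KZ.FormalRep) (h₁ : SectorLifting S)
    (h₂ : ResidualLifting S) : TateLifting := by
  intro c hc
  have hle : AddSubgroup.closure S ⊓ KZ.eval.ker ≤ KZ.relations ⊔ AddSubgroup.closure tateFibres := by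
    intro d hd
    exact h₁ d hd.1 (by simpa [AddMonoidHom.mem_ker] using hd.2)
  exact (sup_le le_rfl hle) (h₂ c hc)

/-- The crux implies BOTH children … -/
theorem sector_of_tateLifting (S : Set KZ.FormalRep) (h : TateLifting) : SectorLifting S :=
  fun c _ hc => h c hc

theorem residual_of_tateLifting (S : Set KZ.FormalRep) (h : TateLifting) : ResidualLifting S :=
  fun c hc => AddSubgroup.mem_sup_left (h c hc)

/-- … so the split is an EQUIVALENCE and the residual child is the crux modulo the sector child:
for every `S`, `ResidualLifting S` is crux-equivalent given `SectorLifting S`. [folklore] -/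
theorem sector_split_iff (S : Set KZ.FormalRep) :
    (SectorLifting S ∧ ResidualLifting S) ↔ TateLifting :=
  ⟨fun h => tateLifting_of_sector_split S h.1 h.2,
    fun h => ⟨sector_of_tateLifting S h, residual_of_tateLifting S h⟩⟩

theorem residual_iff_tateLifting_of_sector (S : Set KZ.FormalRep) (h₁ : SectorLifting S) :
    ResidualLifting S ↔ TateLifting :=
  ⟨tateLifting_of_sector_split S h₁, residual_of_tateLifting S⟩

/-! ## DECOMPOSITION (2) — the normal-form split (pencil card K2 + lifting of normal forms) -/

/-- A representation is CUBE-REGULAR RATIONAL: domain the open unit cube, integrand `P/Q` with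
real-algebraic coefficients and `Q ≠ 0` on the CLOSED cube. [folklore] -/
def IsCubeRegular {n : ℕ} (r : KZ.IntegralRep n) : Prop :=
  ∃ P Q : MvPolynomial (Fin n) ℝ,
    (∀ m, IsAlgebraic ℚ (P.coeff m)) ∧ (∀ m, IsAlgebraic ℚ (Q.coeff m)) ∧
    r.domain = Set.pi Set.univ (fun _ : Fin n => Set.Ioo (0 : ℝ) 1) ∧
    (∀ z : Fin n → ℝ, (∀ i, z i ∈ Set.Icc (0 : ℝ) 1) → MvPolynomial.aeval z Q ≠ 0) ∧
    Set.EqOn r.integrand (fun z => MvPolynomial.aeval z P / MvPolynomial.aeval z Q) r.domain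

/-- Normal-form child (`TatePencilNormalForm` of the pencil-saturation card, an XL
resolution-of-singularities statement INSIDE the KZ calculus; unproved): every formal combination is
congruent modulo the moves to ONE cube-regular rational representation. [folklore] -/
def CubeRegularNormalForm : Prop :=
  ∀ c : KZ.FormalRep, ∃ (n : ℕ) (r : KZ.IntegralRep n), IsCubeRegular r ∧ c - KZ.of r ∈ KZ.relations

/-- Lifting child: the crux for single cube-regular rational representations of value `0`. [folklore] -/
def CubeRegularLifting : Prop :=
  ∀ (n : ℕ) (r : KZ.IntegralRep n), IsCubeRegular r → r.value = 0 →
    KZ.of r ∈ KZ.relations ⊔ AddSubgroup.closure tateFibres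

/-- GLUE of the normal-form split. [folklore] -/
theorem tateLifting_of_normalForm_split (h₁ : CubeRegularNormalForm) (h₂ : CubeRegularLifting) :
    TateLifting := by
  intro c hc
  obtain ⟨n, r, hr, hrel⟩ := h₁ c
  have hv : r.value = 0 := by
    have hker : KZ.eval (c - KZ.of r) = 0 := KZ.relations_le_ker_eval_holds hrel
    rwa [map_sub, hc, zero_sub, neg_eq_zero, KZ.eval_of] at hker
  have := add_mem (AddSubgroup.mem_sup_left (T := AddSubgroup.closure tateFibres) hrel)
    (h₂ n r hr hv)
  rw [sub_add_cancel] at this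
  exact this

/-- The lifting child is a special case of the crux … -/
theorem cubeRegularLifting_of_tateLifting (h : TateLifting) : CubeRegularLifting :=
  fun n r _ hv => h (KZ.of r) (by rw [KZ.eval_of, hv])

/-- … hence crux-EQUIVALENT given the normal-form child: the split moves no difficulty out of the
lifting child. [folklore] -/
theorem cubeRegularLifting_iff_of_normalForm (h₁ : CubeRegularNormalForm) :
    CubeRegularLifting ↔ TateLifting :=
  ⟨tateLifting_of_normalForm_split h₁, cubeRegularLifting_of_tateLifting⟩

/-! ## NEGATION — a counterexample refutes the summit; the invariant form IS the crux -/

/-- A counterexample to the crux is a counterexample to Kontsevich–Zagier's Conjecture 1 as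
formalised (the summit). [cite: KontsevichZagier2001, §1.2 Conjecture 1] -/
theorem not_summit_of_not_tateLifting (h : ¬ TateLifting) : ¬ KontsevichZagierPeriods :=
  fun hs => h (tateLifting_of_summit hs)

/-- INVARIANT FORM. Refuting the crux needs an additive invariant `θ` of formal combinations that
kills every move and every Tate fibre but not some element of `ker eval`; conversely the crux says no
such invariant exists. The two are EQUIVALENT (take `θ` = the quotient map by
`relations ⊔ closure T`), so "find a second invariant" is not a lemma toward either side — it is the
crux itself. [folklore] -/
theorem tateLifting_iff_invariants :
    TateLifting ↔ ∀ (A : Type) [AddCommGroup A] (θ : KZ.FormalRep →+ A),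
      KZ.relations ≤ θ.ker → tateFibres ⊆ θ.ker → KZ.eval.ker ≤ θ.ker := by
  constructor
  · intro h A _ θ hrel hT c hc
    have hc' : KZ.eval c = 0 := by simpa [AddMonoidHom.mem_ker] using hc
    have hle : KZ.relations ⊔ AddSubgroup.closure tateFibres ≤ θ.ker :=
      sup_le hrel ((AddSubgroup.closure_le _).mpr hT)
    exact hle (h c hc')
  · intro h c hc
    set N : AddSubgroup KZ.FormalRep := KZ.relations ⊔ AddSubgroup.closure tateFibres with hN
    have hker : (QuotientAddGroup.mk' N).ker = N := QuotientAddGroup.ker_mk' N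
    have h1 : KZ.relations ≤ (QuotientAddGroup.mk' N).ker := by
      rw [hker]; exact le_sup_left
    have h2 : tateFibres ⊆ (QuotientAddGroup.mk' N).ker := by
      rw [hker]
      exact fun d hd => AddSubgroup.mem_sup_right (AddSubgroup.subset_closure hd)
    have := h (KZ.FormalRep ⧸ N) (QuotientAddGroup.mk' N) h1 h2
      (by simpa [AddMonoidHom.mem_ker] using hc)
    rwa [hker] at this

/-! ## BARRIERS — modulo the accessible crux, the three strength barriers bite on `TateLifting` -/

/-- Modulo `TateFamilyKernel` (the relative, Ayoub-type crux whose `n = 1` case is a theorem of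
the tree), a proof of `TateLifting` proves the summit and therefore — under the catalogued printed
implication `kzConjecture_implies_oddZetaAlgIndep` — the algebraic independence of
`ζ(3), ζ(5), …` and in particular the irrationality of `ζ(5)`.
[cite: HuberWustholz2022, Prologue p. xvi] -/
theorem zetaFiveIrrational_of_tateLifting (hL : TateLifting) (hK : TateFamilyKernel)
    (h : Literature.Barriers.KontsevichZagierPeriods.kzConjecture_implies_oddZetaAlgIndep) :
    ZetaFiveIrrational :=
  Literature.Barriers.KontsevichZagierPeriods.zetaFiveIrrational_of_kz h
    ((tateLifting_iff_summit_of_tateFamilyKernel hK).mp hL)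

/-- Same for the companion barrier: `2πi` and `log q` algebraically independent.
[cite: Fresan2024, Ex. 10.3] -/
theorem twoPiILog_of_tateLifting (hL : TateLifting) (hK : TateFamilyKernel)
    (h : Literature.Barriers.KontsevichZagierPeriods.kzConjecture_implies_twoPiI_log_algIndep) :
    Literature.Barriers.KontsevichZagierPeriods.TwoPiILogAlgIndep :=
  h ((tateLifting_iff_summit_of_tateFamilyKernel hK).mp hL)

/-! ## TRANSFER — the functional (relative) sibling changes the HYPOTHESIS, not the conclusion -/

/-- The statement the solved siblings actually prove has a FUNCTIONAL zero as hypothesis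
(Ayoub's relative theorem / the route's proved `TateFamilyKernelCurves`; Beukers' lifting theorem
for E-functions; the ABP criterion): identically vanishing families have fibres in the target
subgroup. In this calculus that statement is TRIVIALLY TRUE for the target `relations ⊔ closure T`
(a Tate fibre is a Tate fibre) — the transfer lands on the wrong side of the sandwich: it never
touches an ISOLATED numerical zero, which is all the crux is about. [folklore] -/
theorem functional_sibling_is_free :
    ∀ d ∈ tateFibres, d ∈ KZ.relations ⊔ AddSubgroup.closure tateFibres :=
  fun _ hd => AddSubgroup.mem_sup_right (AddSubgroup.subset_closure hd)

end Summit.KontsevichZagierPeriods.InverseLandau.Strategist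

end
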